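import Literature.MathematicalPhysics.QuantumLattice.KohnLuttingerFermiCurvePolar
import Mathlib.Analysis.SpecialFunctions.Trigonometric.InverseDeriv
import HarnessLib

/-!
# Graph branches of the level curve of the anisotropic band `-2(a cos k₀ + b cos k₁)`:
# derivative, arc length (area formula) and the density `‖γ'‖/‖∇ε‖`

First half of Step A of the s-representation of the square-lattice Lindhard function (cell
`gate-hubbard-kl`, item stmt-HubbardSuperconductivity-19294 `LindhardPointwiseIdentification`,
CERT-SREP §1 Prop. 1–2; the `(a, b)`-analogue of `KohnLuttingerFermiCurvePolar.lean`, with GRAPH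
instead of polar parametrisation so that open level curves — `|μ| < 2|a - b|` — are covered too).
For the band `ε(k) = -2(a cos k₀ + b cos k₁)` (`b ≠ 0`) and a level `μ` put
`h(x) = -(μ + 2a cos x)/(2b)`; off the lines `k₁ ∈ {0, -π}` the level curve `{ε = μ}` consists of
the two graphs `γ_ς(x) = (x, ς · arccos h(x))`, `ς = ±1`, over the open set `{|h| < 1}`. Proved here:

* `hasGradientAt_anisoBand`, `norm_gradient_anisoBand` — `∇ε(k) = (2a sin k₀, 2b sin k₁)`;
* `hasDerivAt_anisoBranch` — `γ_ς'(x) = (1, -ς h'(x)/√(1 - h(x)²))`, `h' = a sin / b`;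
* `map_anisoBranch_withDensity_speed`, `lintegral_image_anisoBranch` — **arc length on a branch**
  via the tree's area formula (`Literature.Geometry.GeometricMeasureTheory`, injective `C¹`
  immersions, `P = ℝ`): `γ_ς_* (‖γ_ς'‖ dx ⌞ S) = μH[1] ⌞ γ_ς(S)` for measurable `S ⊆ {|h| < 1}`;
* `anisoBranch_density` — `‖∇ε(γ_ς x)‖⁻¹ ‖γ_ς'(x)‖ = 1/√(4b² - (μ + 2a cos x)²)` (`= 1/(2b|sin k₁|)`).

The assembly (`fermiCurveMeasure ε μ univ = ∫ 2/√(4b² - (μ + 2a cos x)²) dx`) is in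
`AnisotropicBandFermiCurveMeasure.lean`. Theorems only, no definitions (the band and the branches
are written as explicit lambdas).

## References
* H. Federer, *Geometric Measure Theory* (1969) 3.2.3, 3.2.5 (area formula) [Federer1969].
* S. Raghu, S. A. Kivelson, D. J. Scalapino, Phys. Rev. B 81 (2010) 224505, §II (6) (DOS measure)
  [RaghuKivelsonScalapino2010].
-/

noncomputable section

open Real Set MeasureTheory MeasureTheory.Measure
open scoped Topology ENNReal RealInnerProductSpace

namespace Literature.MathematicalPhysics.QuantumLattice

/-! ### The anisotropic band and its gradient -/

/-- **Gradient of the anisotropic band**: for `ε(k) = -2(a cos k₀ + b cos k₁)`,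
`∇ε(k) = (2a sin k₀, 2b sin k₁)`. [cite: RaghuKivelsonScalapino2010, §II (6)] -/
theorem hasGradientAt_anisoBand (a b : ℝ) (k : Momentum) :
    HasGradientAt (fun k : Momentum => -2 * (a * Real.cos (k 0) + b * Real.cos (k 1)))
      (WithLp.toLp 2 ![2 * a * Real.sin (k 0), 2 * b * Real.sin (k 1)]) k := by
  rw [hasGradientAt_iff_hasFDerivAt]
  set P0 : Momentum →L[ℝ] ℝ := PiLp.proj 2 (fun _ : Fin 2 => ℝ) (0 : Fin 2) with hP0
  set P1 : Momentum →L[ℝ] ℝ := PiLp.proj 2 (fun _ : Fin 2 => ℝ) (1 : Fin 2) with hP1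
  have hc0 : HasDerivAt Real.cos (-Real.sin (k 0)) (P0 k) := Real.hasDerivAt_cos (k 0)
  have hc1 : HasDerivAt Real.cos (-Real.sin (k 1)) (P1 k) := Real.hasDerivAt_cos (k 1)
  have h0 : HasFDerivAt (Real.cos ∘ ⇑P0) (-Real.sin (k 0) • P0) k := hc0.comp_hasFDerivAt k P0.hasFDerivAt
  have h1 : HasFDerivAt (Real.cos ∘ ⇑P1) (-Real.sin (k 1) • P1) k := hc1.comp_hasFDerivAt k P1.hasFDerivAt
  have h := ((h0.const_mul a).add (h1.const_mul b)).const_mul (-2 : ℝ)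
  have hfun : (fun k : Momentum => -2 * (a * Real.cos (k 0) + b * Real.cos (k 1))) =
      fun q : Momentum => (-2 : ℝ) * (a * (Real.cos ∘ ⇑P0) q + b * (Real.cos ∘ ⇑P1) q) := by
    funext q; simp [hP0, hP1]
  rw [hfun]
  refine h.congr_fderiv ?_
  ext q
  rw [InnerProductSpace.toDual_apply_apply]
  simp [hP0, hP1, PiLp.inner_apply, Fin.sum_univ_two]
  ring

/-- `∇ε(k) = (2a sin k₀, 2b sin k₁)` for the anisotropic band. [cite: RaghuKivelsonScalapino2010, §II (6)] -/
theorem gradient_anisoBand (a b : ℝ) (k : Momentum) :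
    gradient (fun k : Momentum => -2 * (a * Real.cos (k 0) + b * Real.cos (k 1))) k =
      WithLp.toLp 2 ![2 * a * Real.sin (k 0), 2 * b * Real.sin (k 1)] :=
  (hasGradientAt_anisoBand a b k).gradient

/-- `‖∇ε(k)‖ = √(4a² sin² k₀ + 4b² sin² k₁)` for the anisotropic band. [cite: RaghuKivelsonScalapino2010, §II (6)] -/
theorem norm_gradient_anisoBand (a b : ℝ) (k : Momentum) :
    ‖gradient (fun k : Momentum => -2 * (a * Real.cos (k 0) + b * Real.cos (k 1))) k‖ =
      Real.sqrt (4 * a ^ 2 * Real.sin (k 0) ^ 2 + 4 * b ^ 2 * Real.sin (k 1) ^ 2) := by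
  rw [gradient_anisoBand, EuclideanSpace.norm_eq, Fin.sum_univ_two]
  simp only [Matrix.cons_val_zero, Matrix.cons_val_one, Real.norm_eq_abs, sq_abs]
  congr 1; ring

/-- The gradient of the anisotropic band is continuous. [cite: RaghuKivelsonScalapino2010, §II (6)] -/
theorem continuous_gradient_anisoBand (a b : ℝ) :
    Continuous (gradient (fun k : Momentum => -2 * (a * Real.cos (k 0) + b * Real.cos (k 1)))) := by
  have : gradient (fun k : Momentum => -2 * (a * Real.cos (k 0) + b * Real.cos (k 1))) =
      fun k : Momentum => WithLp.toLp 2 ![2 * a * Real.sin (k 0), 2 * b * Real.sin (k 1)] :=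
    funext (gradient_anisoBand a b)
  rw [this]
  refine (PiLp.continuous_toLp 2 _).comp (continuous_pi fun i => ?_)
  have h0 : Continuous fun k : Momentum => 2 * a * Real.sin (k 0) :=
    continuous_const.mul (Real.continuous_sin.comp (PiLp.continuous_apply 2 _ (0 : Fin 2)))
  have h1 : Continuous fun k : Momentum => 2 * b * Real.sin (k 1) :=
    continuous_const.mul (Real.continuous_sin.comp (PiLp.continuous_apply 2 _ (1 : Fin 2)))
  fin_cases i
  · simpa using h0
  · simpa using h1

/-- The inverse speed `‖∇ε‖⁻¹` of the anisotropic band is a measurable `ℝ≥0∞`-weight. [cite: RaghuKivelsonScalapino2010, §II (6)] -/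
theorem measurable_invSpeed_anisoBand (a b : ℝ) :
    Measurable fun k : Momentum =>
      ENNReal.ofReal (‖gradient (fun k : Momentum => -2 * (a * Real.cos (k 0) + b * Real.cos (k 1))) k‖⁻¹) :=
  ENNReal.measurable_ofReal.comp ((continuous_gradient_anisoBand a b).norm.measurable.inv)

/-- The anisotropic band is continuous. [cite: RaghuKivelsonScalapino2010, §II (6)] -/
theorem continuous_anisoBand (a b : ℝ) :
    Continuous (fun k : Momentum => -2 * (a * Real.cos (k 0) + b * Real.cos (k 1))) := by
  have h0 : Continuous fun k : Momentum => Real.cos (k 0) :=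
    Real.continuous_cos.comp (PiLp.continuous_apply 2 _ (0 : Fin 2))
  have h1 : Continuous fun k : Momentum => Real.cos (k 1) :=
    Real.continuous_cos.comp (PiLp.continuous_apply 2 _ (1 : Fin 2))
  exact continuous_const.mul ((continuous_const.mul h0).add (continuous_const.mul h1))

/-! ### The two graph branches `x ↦ (x, ± arccos h(x))`, `h(x) = -(μ + 2a cos x)/(2b)` -/

section Branch

variable {a b μ ς : ℝ}

/-- Derivative of the level function `h(x) = -(μ + 2a cos x)/(2b)`: `h'(x) = a sin x / b`. (a hypothesis of the area formula) [cite: Federer1969, 3.2.3] -/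
theorem hasDerivAt_anisoLevelFn (a b μ x : ℝ) (hb : b ≠ 0) :
    HasDerivAt (fun x : ℝ => -(μ + 2 * a * Real.cos x) / (2 * b)) (a * Real.sin x / b) x := by
  have h := (((Real.hasDerivAt_cos x).const_mul (2 * a)).const_add μ).neg.div_const (2 * b)
  refine h.congr_deriv ?_
  field_simp

/-- **Velocity of a graph branch**: on `{|h| < 1}` the branch `γ_ς(x) = (x, ς · arccos h(x))`
(`ς = ±1`) of the level curve of the anisotropic band has derivative
`γ_ς'(x) = (1, -ς h'(x)/√(1 - h(x)²))`. (a hypothesis of the area formula) [cite: Federer1969, 3.2.3] -/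
theorem hasDerivAt_anisoBranch (a b μ ς x : ℝ) (hb : b ≠ 0)
    (hx : -(μ + 2 * a * Real.cos x) / (2 * b) ∈ Ioo (-1 : ℝ) 1) :
    HasDerivAt (fun x : ℝ => WithLp.toLp 2 ![x, ς * Real.arccos (-(μ + 2 * a * Real.cos x) / (2 * b))])
      (WithLp.toLp 2 ![1, ς * (-(1 / Real.sqrt (1 - (-(μ + 2 * a * Real.cos x) / (2 * b)) ^ 2)) *
        (a * Real.sin x / b))]) x := by
  set h : ℝ → ℝ := fun x => -(μ + 2 * a * Real.cos x) / (2 * b) with hh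
  have hd : HasDerivAt h (a * Real.sin x / b) x := hasDerivAt_anisoLevelFn a b μ x hb
  have h1 : h x ≠ -1 := ne_of_gt hx.1
  have h2 : h x ≠ 1 := ne_of_lt hx.2
  have harc : HasDerivAt (fun x => Real.arccos (h x))
      (-(1 / Real.sqrt (1 - h x ^ 2)) * (a * Real.sin x / b)) x :=
    (Real.hasDerivAt_arccos h1 h2).comp x hd
  have hg : HasDerivAt (fun x => (![x, ς * Real.arccos (h x)] : Fin 2 → ℝ))
      (![1, ς * (-(1 / Real.sqrt (1 - h x ^ 2)) * (a * Real.sin x / b))]) x := by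
    refine hasDerivAt_pi.2 fun i => ?_
    fin_cases i
    · simp only [Fin.zero_eta, Matrix.cons_val_zero]
      exact hasDerivAt_id' x
    · simp only [Fin.mk_one, Matrix.cons_val_one, Matrix.cons_val_zero]
      exact harc.const_mul ς
  set L : (Fin 2 → ℝ) →L[ℝ] EuclideanSpace ℝ (Fin 2) :=
    (PiLp.continuousLinearEquiv 2 ℝ (fun _ : Fin 2 => ℝ)).symm.toContinuousLinearMap with hL
  have hcomp := L.hasFDerivAt.comp_hasDerivAt x hg
  exact hcomp

/-- The branch maps are continuous (everywhere). (a hypothesis of the area formula) [cite: Federer1969, 3.2.3] -/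
theorem continuous_anisoBranch (a b μ ς : ℝ) :
    Continuous (fun x : ℝ => WithLp.toLp 2 ![x, ς * Real.arccos (-(μ + 2 * a * Real.cos x) / (2 * b))] :
      ℝ → Momentum) := by
  refine (PiLp.continuous_toLp 2 _).comp (continuous_pi fun i => ?_)
  fin_cases i
  · simp only [Fin.zero_eta, Matrix.cons_val_zero]
    exact continuous_id'
  · simp only [Fin.mk_one, Matrix.cons_val_one, Matrix.cons_val_zero]
    exact continuous_const.mul (Real.continuous_arccos.comp (by fun_prop))

/-- The branch maps are injective (the first coordinate is the parameter). (a hypothesis of the area formula) [cite: Federer1969, 3.2.3] -/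
theorem injective_anisoBranch (a b μ ς : ℝ) :
    Function.Injective (fun x : ℝ => WithLp.toLp 2 ![x, ς * Real.arccos (-(μ + 2 * a * Real.cos x) / (2 * b))] :
      ℝ → Momentum) := by
  intro x y hxy
  have := congrArg (fun k : Momentum => k 0) hxy
  simpa using this

/-- The open parameter set `{x | |h(x)| < 1}` of the graph branches. (a hypothesis of the area formula) [cite: Federer1969, 3.2.3] -/
theorem isOpen_anisoBranchDom (a b μ : ℝ) :
    IsOpen {x : ℝ | -(μ + 2 * a * Real.cos x) / (2 * b) ∈ Ioo (-1 : ℝ) 1} :=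
  isOpen_Ioo.preimage (by fun_prop)

/-- The velocity field of a branch is continuous on the parameter set `{|h| < 1}`. (a hypothesis of the area formula) [cite: Federer1969, 3.2.3] -/
theorem continuousOn_anisoBranchVelocity (a b μ ς : ℝ) :
    ContinuousOn (fun x : ℝ => (WithLp.toLp 2 ![1, ς * (-(1 / Real.sqrt (1 - (-(μ + 2 * a * Real.cos x) / (2 * b)) ^ 2)) *
        (a * Real.sin x / b))] : Momentum))
      {x : ℝ | -(μ + 2 * a * Real.cos x) / (2 * b) ∈ Ioo (-1 : ℝ) 1} := by
  set U := {x : ℝ | -(μ + 2 * a * Real.cos x) / (2 * b) ∈ Ioo (-1 : ℝ) 1} with hU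
  have hsq : ∀ x ∈ U, Real.sqrt (1 - (-(μ + 2 * a * Real.cos x) / (2 * b)) ^ 2) ≠ 0 := by
    intro x hx
    have h1 : (-(μ + 2 * a * Real.cos x) / (2 * b)) ^ 2 < 1 := by
      have := hx.1; have := hx.2
      nlinarith
    exact (Real.sqrt_pos.2 (by linarith)).ne'
  have h1 : ContinuousOn (fun x : ℝ => Real.sqrt (1 - (-(μ + 2 * a * Real.cos x) / (2 * b)) ^ 2)) U := by
    fun_prop
  have h2 : ContinuousOn (fun x : ℝ => a * Real.sin x / b) U := by fun_prop
  have hc' := ((continuousOn_const (c := ς)).mul (((continuousOn_const (c := (1 : ℝ))).div h1 hsq).neg)).mul h2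
  have hc : ContinuousOn (fun x : ℝ => ς * (-(1 / Real.sqrt (1 - (-(μ + 2 * a * Real.cos x) / (2 * b)) ^ 2)) *
      (a * Real.sin x / b))) U :=
    hc'.congr fun x _ => by simp only [Pi.mul_apply, Pi.neg_apply, Pi.div_apply]; ring
  refine (PiLp.continuous_toLp 2 _).comp_continuousOn (continuousOn_pi.2 fun i => ?_)
  fin_cases i
  · simp only [Fin.zero_eta, Matrix.cons_val_zero]
    exact continuousOn_const
  · simp only [Fin.mk_one, Matrix.cons_val_one, Matrix.cons_val_zero]
    exact hc

/-- **Arc length on a graph branch** (the tree's area formula with `P = ℝ`, `n = 1`): for a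
measurable `S ⊆ {|h| < 1}`, `γ_ς_* (‖γ_ς'‖ dx ⌞ S) = μH[1] ⌞ γ_ς(S)`. [cite: Federer1969, 3.2.3] -/
theorem map_anisoBranch_withDensity_speed (a b μ ς : ℝ) (hb : b ≠ 0) {S : Set ℝ}
    (hS : MeasurableSet S) (hSU : S ⊆ {x : ℝ | -(μ + 2 * a * Real.cos x) / (2 * b) ∈ Ioo (-1 : ℝ) 1}) :
    Measure.map (fun x : ℝ => (WithLp.toLp 2 ![x, ς * Real.arccos (-(μ + 2 * a * Real.cos x) / (2 * b))] : Momentum))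
        ((volume.restrict S).withDensity fun x => ENNReal.ofReal
          ‖(WithLp.toLp 2 ![1, ς * (-(1 / Real.sqrt (1 - (-(μ + 2 * a * Real.cos x) / (2 * b)) ^ 2)) *
            (a * Real.sin x / b))] : Momentum)‖) =
      (μH[1] : Measure Momentum).restrict
        ((fun x : ℝ => (WithLp.toLp 2 ![x, ς * Real.arccos (-(μ + 2 * a * Real.cos x) / (2 * b))] : Momentum)) '' S) := by
  set U := {x : ℝ | -(μ + 2 * a * Real.cos x) / (2 * b) ∈ Ioo (-1 : ℝ) 1} with hU
  set γ : ℝ → Momentum := fun x => WithLp.toLp 2 ![x, ς * Real.arccos (-(μ + 2 * a * Real.cos x) / (2 * b))]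
    with hγ
  set v : ℝ → Momentum := fun x => WithLp.toLp 2 ![1, ς * (-(1 / Real.sqrt (1 - (-(μ + 2 * a * Real.cos x) / (2 * b)) ^ 2)) *
        (a * Real.sin x / b))] with hv
  set F' : ℝ → ℝ →L[ℝ] Momentum := fun x => ContinuousLinearMap.smulRight (1 : ℝ →L[ℝ] ℝ) (v x) with hF'
  have hF : ∀ x ∈ U, HasFDerivAt γ (F' x) x := fun x hx =>
    (hasDerivAt_anisoBranch a b μ ς x hb hx).hasFDerivAt
  have hvc : ContinuousOn v U := continuousOn_anisoBranchVelocity a b μ ς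
  have hF'c : ContinuousOn F' U := by
    have : F' = fun x => ContinuousLinearMap.smulRightL ℝ ℝ Momentum (1 : ℝ →L[ℝ] ℝ) (v x) := by
      funext x; rfl
    rw [this]
    exact (ContinuousLinearMap.smulRightL ℝ ℝ Momentum (1 : ℝ →L[ℝ] ℝ)).continuous.comp_continuousOn hvc
  have hinj : InjOn γ U := (injective_anisoBranch a b μ ς).injOn
  have hv0 : ∀ x, v x ≠ 0 := fun x h0 => by
    have := congrArg (fun k : Momentum => k 0) h0
    simp [hv] at this
  have himm : ∀ x ∈ U, Function.Injective (F' x) := fun x _ => by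
    intro s t hst
    have hst' : s • v x = t • v x := by simpa [hF'] using hst
    exact smul_left_injective ℝ (hv0 x) hst'
  have key := Literature.Geometry.GeometricMeasureTheory.map_withDensity_sqrt_det_gram_eq_restrict_image
    (OrthonormalBasis.singleton (Fin 1) ℝ) (isOpen_anisoBranchDom a b μ) hF hF'c hinj himm hS hSU
  have hF'1 : ∀ x : ℝ, F' x 1 = v x := fun x => by simp [hF']
  convert key using 3
  · funext x
    show ENNReal.ofReal ‖v x‖ = ENNReal.ofReal (Real.sqrt (Matrix.of fun i j : Fin 1 =>
      ⟪F' x (OrthonormalBasis.singleton (Fin 1) ℝ i), F' x (OrthonormalBasis.singleton (Fin 1) ℝ j)⟫).det)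
    rw [Matrix.det_fin_one, Matrix.of_apply, OrthonormalBasis.singleton_apply, hF'1,
      real_inner_self_eq_norm_sq, Real.sqrt_sq (norm_nonneg _)]
  · rw [Module.finrank_self, euclideanHausdorffMeasure_one]

/-- **Integration over a graph branch**: `∫_{γ_ς(S)} g dμH[1] = ∫_S g(γ_ς x) ‖γ_ς'(x)‖ dx` for
measurable `g ≥ 0` and measurable `S ⊆ {|h| < 1}`. [cite: Federer1969, 3.2.5] -/
theorem lintegral_image_anisoBranch (a b μ ς : ℝ) (hb : b ≠ 0) {S : Set ℝ}
    (hS : MeasurableSet S) (hSU : S ⊆ {x : ℝ | -(μ + 2 * a * Real.cos x) / (2 * b) ∈ Ioo (-1 : ℝ) 1})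
    {g : Momentum → ℝ≥0∞} (hg : Measurable g) :
    ∫⁻ k in (fun x : ℝ => (WithLp.toLp 2 ![x, ς * Real.arccos (-(μ + 2 * a * Real.cos x) / (2 * b))] : Momentum)) '' S,
        g k ∂(μH[1] : Measure Momentum) =
      ∫⁻ x in S, g (WithLp.toLp 2 ![x, ς * Real.arccos (-(μ + 2 * a * Real.cos x) / (2 * b))]) *
        ENNReal.ofReal ‖(WithLp.toLp 2 ![1, ς * (-(1 / Real.sqrt (1 - (-(μ + 2 * a * Real.cos x) / (2 * b)) ^ 2)) *
          (a * Real.sin x / b))] : Momentum)‖ := by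
  set γ : ℝ → Momentum := fun x => WithLp.toLp 2 ![x, ς * Real.arccos (-(μ + 2 * a * Real.cos x) / (2 * b))]
    with hγ
  have hγm : Measurable γ := (continuous_anisoBranch a b μ ς).measurable
  have h1 : Measurable (fun x : ℝ => Real.sqrt (1 - (-(μ + 2 * a * Real.cos x) / (2 * b)) ^ 2)) := by
    fun_prop
  have h2 : Measurable (fun x : ℝ => a * Real.sin x / b) := by fun_prop
  have hρm : Measurable (fun x : ℝ => ENNReal.ofReal ‖(WithLp.toLp 2 ![1, ς * (-(1 / Real.sqrt
      (1 - (-(μ + 2 * a * Real.cos x) / (2 * b)) ^ 2)) * (a * Real.sin x / b))] : Momentum)‖) := by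
    refine ENNReal.measurable_ofReal.comp (Measurable.norm ?_)
    refine (PiLp.continuous_toLp 2 _).measurable.comp (measurable_pi_iff.2 fun i => ?_)
    fin_cases i
    · simp only [Fin.zero_eta, Matrix.cons_val_zero]; exact measurable_const
    · simp only [Fin.mk_one, Matrix.cons_val_one, Matrix.cons_val_zero]
      have hm := ((measurable_const (a := ς)).mul (((measurable_const (a := (1 : ℝ))).div h1).neg)).mul h2
      have heq : ((fun _ : ℝ => ς) * -((fun _ : ℝ => (1 : ℝ)) / fun x : ℝ =>
          Real.sqrt (1 - (-(μ + 2 * a * Real.cos x) / (2 * b)) ^ 2)) * fun x : ℝ => a * Real.sin x / b) =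
          fun x : ℝ => ς * (-(1 / Real.sqrt (1 - (-(μ + 2 * a * Real.cos x) / (2 * b)) ^ 2)) *
            (a * Real.sin x / b)) := by
        funext x; simp only [Pi.mul_apply, Pi.neg_apply, Pi.div_apply]; ring
      rw [heq] at hm
      exact hm
  have hgγ : AEMeasurable (fun x : ℝ => g (γ x)) (volume.restrict S) := (hg.comp hγm).aemeasurable
  rw [← map_anisoBranch_withDensity_speed a b μ ς hb hS hSU, lintegral_map hg hγm,
    lintegral_withDensity_eq_lintegral_mul₀ hρm.aemeasurable hgγ]
  refine lintegral_congr fun x => ?_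
  simp only [Pi.mul_apply, hγ]
  ring

/-- **The density on a graph branch**: `‖∇ε(γ_ς x)‖⁻¹ · ‖γ_ς'(x)‖ = 1/√(4b² - (μ + 2a cos x)²)`
(`= 1/(2b |sin k₁|)`) for `b > 0`, `ς = ±1`, `|h(x)| < 1`. [cite: RaghuKivelsonScalapino2010, §II (6)] -/
theorem anisoBranch_density (a b μ ς x : ℝ) (hb : 0 < b) (hς : ς = 1 ∨ ς = -1)
    (hx : -(μ + 2 * a * Real.cos x) / (2 * b) ∈ Ioo (-1 : ℝ) 1) :
    ENNReal.ofReal (‖gradient (fun k : Momentum => -2 * (a * Real.cos (k 0) + b * Real.cos (k 1)))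
        (WithLp.toLp 2 ![x, ς * Real.arccos (-(μ + 2 * a * Real.cos x) / (2 * b))])‖⁻¹) *
      ENNReal.ofReal ‖(WithLp.toLp 2 ![1, ς * (-(1 / Real.sqrt (1 - (-(μ + 2 * a * Real.cos x) / (2 * b)) ^ 2)) *
        (a * Real.sin x / b))] : Momentum)‖ =
      ENNReal.ofReal (1 / Real.sqrt (4 * b ^ 2 - (μ + 2 * a * Real.cos x) ^ 2)) := by
  set h : ℝ := -(μ + 2 * a * Real.cos x) / (2 * b) with hh
  have hb0 : b ≠ 0 := hb.ne'
  have hς2 : ς ^ 2 = 1 := by rcases hς with rfl | rfl <;> norm_num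
  have h1h : 0 < 1 - h ^ 2 := by have := hx.1; have := hx.2; nlinarith
  -- `D = 4b² - (μ + 2a cos x)² = 4b²(1 - h²) > 0`
  have hD : 4 * b ^ 2 - (μ + 2 * a * Real.cos x) ^ 2 = 4 * b ^ 2 * (1 - h ^ 2) := by
    rw [hh]; field_simp; ring
  have hDpos : 0 < 4 * b ^ 2 - (μ + 2 * a * Real.cos x) ^ 2 := by rw [hD]; positivity
  -- the sine of the second coordinate
  have hsin : Real.sin (ς * Real.arccos h) ^ 2 = 1 - h ^ 2 := by
    have hs : Real.sin (Real.arccos h) ^ 2 = 1 - h ^ 2 := by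
      rw [Real.sin_arccos, Real.sq_sqrt h1h.le]
    rcases hς with rfl | rfl
    · simpa using hs
    · rw [show (-1 : ℝ) * Real.arccos h = -Real.arccos h by ring, Real.sin_neg, neg_sq, hs]
  -- the two norms
  have hgrad : ‖gradient (fun k : Momentum => -2 * (a * Real.cos (k 0) + b * Real.cos (k 1)))
      (WithLp.toLp 2 ![x, ς * Real.arccos h])‖ =
      Real.sqrt (4 * a ^ 2 * Real.sin x ^ 2 + (4 * b ^ 2 - (μ + 2 * a * Real.cos x) ^ 2)) := by
    rw [norm_gradient_anisoBand]
    congr 1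
    simp only [Matrix.cons_val_zero, Matrix.cons_val_one]
    rw [hsin, hD]
  have hvel : ‖(WithLp.toLp 2 ![1, ς * (-(1 / Real.sqrt (1 - h ^ 2)) * (a * Real.sin x / b))] : Momentum)‖ =
      Real.sqrt ((4 * a ^ 2 * Real.sin x ^ 2 + (4 * b ^ 2 - (μ + 2 * a * Real.cos x) ^ 2)) /
        (4 * b ^ 2 - (μ + 2 * a * Real.cos x) ^ 2)) := by
    rw [EuclideanSpace.norm_eq, Fin.sum_univ_two]
    simp only [Matrix.cons_val_zero, Matrix.cons_val_one, Real.norm_eq_abs, sq_abs]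
    congr 1
    have hsq : Real.sqrt (1 - h ^ 2) ^ 2 = 1 - h ^ 2 := Real.sq_sqrt h1h.le
    have hsq0 : Real.sqrt (1 - h ^ 2) ≠ 0 := (Real.sqrt_pos.2 h1h).ne'
    rw [hD]
    field_simp
    rw [hsq, hς2]
    ring
  set A : ℝ := 4 * a ^ 2 * Real.sin x ^ 2 + (4 * b ^ 2 - (μ + 2 * a * Real.cos x) ^ 2) with hA
  set D : ℝ := 4 * b ^ 2 - (μ + 2 * a * Real.cos x) ^ 2 with hD'
  have hApos : 0 < A := by rw [hA]; positivity
  rw [hgrad, hvel, ← ENNReal.ofReal_mul (inv_nonneg.2 (Real.sqrt_nonneg _))]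
  congr 1
  rw [Real.sqrt_div hApos.le, one_div]
  have hA0 : Real.sqrt A ≠ 0 := (Real.sqrt_pos.2 hApos).ne'
  field_simp

end Branch

end Literature.MathematicalPhysics.QuantumLattice

end
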